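import Summits.HodgeConjecture.HodgeConjecture.Theorems.Ring2AbelianAllAndreFibreClassDivisorRung
import HarnessLib

/-!
# Ring 2 · sub-cell AbelianAll (ALL ABELIAN VARIETIES), André axis, part XIV-c — the EXTREME DEGREES `p = 0`,
# `p = d` of the fibre-class Lefschetz operator hold on EVERY compact pencil of abelian `d`-folds (cycles
# `𝒳 × Hᵈ`, `Hᵈ × 𝒳`), and (β′_f) HOLDS OUTRIGHT for compact pencils of abelian SURFACES whose invariant `H²`
# is spanned by divisor classes on one fibre — explicit codimension-2 cycles on the sixfold `𝒳 × 𝒳`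

HONEST FRAMING (page 1, verbatim): **research route, not a corollary; conditional on HC_CM plus one named
minimal statement.** Cell line: research route conditional on HC_CM; not a corollary; Q11.4-sentence-2
already refuted in dim ≥ 3. Nothing in this file proves a case of the Hodge conjecture for an abelian variety.
`HC_CM` = `Theses.RankFourFaces.CMAbelianHodge` (a BINDER), item `Theses.RankFourFaces.CMToAbelian` (stmt-16267)
OPEN and not closed here. Seat `pub-hodge-ring2-ab-andre-2`, gen 6 (RING2-MAP §AbelianAll AA2.39–AA2.41).

## What is proved (theorems only; no definition, no named fact, no sorry, no Hodge-conjecture input)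

Part VIII's repaired node (β′_f) `FibreClassLefschetzOn hf` asks, for each `p ≤ d`, for a linear map
`T : H²ᵖ⁺²(𝒳(ℂ)) → H²ᵖ(𝒳(ℂ))` INDUCED BY AN ALGEBRAIC CORRESPONDENCE of the total space `𝒳` of the compact pencil
`f : 𝒳 ⟶ S` of abelian `d`-folds with `j_s^* T(j_{t*} j_t^* W) = j_s^* W` (all `W, t, s`). With part XIV-a's action
formula for cross-product correspondences (`exists_crossTrace`) and part XIV-b's algebraic Lefschetz class `K`:

* §1 `map_fiberι_lefschetzPowTo_one_ne_zero` — `K_tᵈ ≠ 0` on every fibre (hard Lefschetz `H⁰ ⥲ H²ᵈ`, `1 ≠ 0`).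
* §2 **`fibreClassLefschetz_degZero`** — the clause `p = 0` for EVERY compact pencil of abelian `d`-folds, by the
  codimension-`d` class `c₀ · pr₂^* Kᵈ = c₀ [𝒳 × Hᵈ]`, `c₀ = τ([𝒳_{t₀}] ∪ Kᵈ)⁻¹` (`[𝒳_{t₀}] ∪ Kᵈ = j_{t₀*} K_{t₀}ᵈ ≠ 0`
  by §1 and part XI's top-degree injectivity; fibre-class constancy (φ) moves `t` to `t₀`).
* §3 **`fibreClassLefschetz_degTop`** — the clause `p = d` for EVERY compact pencil, by `c₀ · pr₁^* Kᵈ = c₀ [Hᵈ × 𝒳]`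
  (`H²ᵈ(𝒳_{t₀})` is the line through `K_{t₀}ᵈ`; (φ) and flatness `map_fiberι_eq_zero_of_eq_zero`).
* §4 **`fibreClassLefschetzOn_relDim_two_of_divisorSpan : FibreClassLefschetzOn hf`** for every compact pencil of
  abelian SURFACES (`d = 2`, `𝒳` a threefold) with a point `t₀` at which `j_{t₀}^* H²(𝒳) = j_{t₀}^*(N¹ H²(𝒳))`:
  degrees `0, 1, 2` = §2, part XIV-b (`∑ᵢ Dᵢ × Aᵢ`, products of divisors), §3. The typed Abdulali Conjecture 5.3 /
  base half of `B(𝒳)` for these threefolds, with the cycles written down; `algebraicFibreClassQuasiInverseOn_…`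
  (part X-b's (A_f)); `fibreClassLefschetz_extremeDegrees` (§2 ∨ §3 packaged).

LADDER AFTER THIS PART: `d ≤ 1` unconditional (parts XI, XIII-f); `d = 2` under the one-fibre divisor-span
hypothesis (here); every `d`: `p ∈ {0, d}` unconditional, `p = 1` under the hypothesis (XIV-b); OPEN: the
middle degrees `1 < p < d` (`d ≥ 3`; `p = d - 1` is the Poincaré-dual of `p = 1`, part XIV-d), in particular the
W₆ habitat (`d = 6`, `p = 2, 3, 4`). The hypothesis fails exactly when `I₂ = j^* H²(𝒳)` has a transcendental part
(e.g. isotrivial pencils with `G ⊂ SL(H^{1,0})`), where a different cycle (the quotient correspondence) is needed.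

References: Abdulali1994FamiliesAV (Conj. 5.3, Thm. 5.5 p. 1130); Andre1996Motifs (§5.1 p. 25, §6.3 Remarque 2
p. 33); VoisinHodgeII2003 ((10.7)); VoisinHodgeI2002 (§6.2.3 Thm. 6.25, §7.3.2); Fulton1998 (§19.1 Prop. 19.1.1);
HatcherAT2002 (§3.1 p. 199, §3.3 Thm. 3.26, Prop. 3.38); FultonYoungTableaux1997 (App. B (5)–(6)).
-/

noncomputable section

set_option linter.dupNamespace false

namespace Summit.HodgeConjecture.HodgeConjecture.Ring2.AbelianAll

open CategoryTheory AlgebraicGeometry MonoidalCategory CartesianMonoidalCategory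
open Literature.AlgebraicGeometry Literature.AlgebraicGeometry.Motives
open Literature.AlgebraicGeometry.HodgeTheory
open Literature.AlgebraicTopology.SingularHomology (singularCohomology cupProduct cupProduct_one'
  cupProduct_assoc cupProduct_gradedComm_holds singularCohomologyZeroEquiv cupPairing
  isPerfPair_cupPairing_of_field_holds)
open Literature.Geometry.Kaehler (HasHardLefschetzProperty)

variable {𝒳 S : SchemeOver ℂ}

/-! ## §1 The top power `Kᵈ` of the Lefschetz class restricts non-trivially to every fibre -/

/-- For a global class `K` with hard Lefschetz on every fibre of a compact pencil of abelian `d`-folds,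
`j_t^*(Lᴷᵈ 1) = L_{K_t}ᵈ 1 ≠ 0` in `H²ᵈ(𝒳_t(ℂ); ℂ)` (`Lᵈ : H⁰ ⥲ H²ᵈ` on the fibre and `1 ≠ 0`, the fibre
being path connected). [cite: VoisinHodgeI2002, §6.2.3 Thm. 6.25] [cite: HatcherAT2002, §3.1 p. 199] -/
theorem map_fiberι_lefschetzPowTo_one_ne_zero {d : ℕ} {f : 𝒳 ⟶ S} (hf : IsCompactAbelianPencil f d)
    {K : complexBetti 𝒳 2} (hKL : ∀ s : ComplexPoints S, HasHardLefschetzProperty (complexBetti.map (fiberι f s) 2 K) d)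
    (h0 : 0 + 2 * d = 2 * d) (t : ComplexPoints S) :
    complexBetti.map (fiberι f t) (2 * d)
      (lefschetzPowTo K d 0 (2 * d) h0 (singularCohomology.one ℂ (ComplexPoints 𝒳))) ≠ 0 := by
  haveI := pathConnectedSpace_complexPoints (hf.isSmoothProjective_fiberOver t)
  rw [map_fiberι_lefschetzPowTo t K d 0 (2 * d) h0,
    show complexBetti.map (fiberι f t) 0 (singularCohomology.one ℂ (ComplexPoints 𝒳)) =
      singularCohomology.one ℂ (ComplexPoints (fiberOver f t)) from
      Literature.AlgebraicTopology.SingularHomology.singularCohomology.map_one _]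
  intro h
  have hinj := (bijective_lefschetzPowTo_of_hasHardLefschetz _ (hKL t) (show 0 + d = d by omega) _ h0).1
  have h1 : singularCohomology.one ℂ (ComplexPoints (fiberOver f t)) = 0 := hinj (by rw [h, map_zero])
  have h2 := Literature.AlgebraicTopology.SingularHomology.singularCohomologyZeroEquiv_one ℂ
    (X := ComplexPoints (fiberOver f t))
  rw [h1, map_zero] at h2
  exact zero_ne_one h2

/-! ## §2 Degree `p = 0`: the cycle `𝒳 × Hᵈ` -/

/-- **The `p = 0` clause of (β′_f), UNCONDITIONALLY, for every compact pencil of abelian `d`-folds**: there is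
`T : H²(𝒳(ℂ)) → H⁰(𝒳(ℂ))` induced by an algebraic correspondence — the action of the codimension-`d` class
`c₀ · pr₂^*(Kᵈ)` (`= c₀ · [𝒳 × Hᵈ]`, `K` an algebraic hyperplane-type class, `c₀ = τ([𝒳_{t₀}] ∪ Kᵈ)⁻¹`) — with
`j_s^* T(j_{t*} j_t^* W) = j_s^* W` for all `W ∈ H⁰`, `t`, `s`: `W = w · 1`, `j_{t*} j_t^* W = w · [𝒳_t] = w · [𝒳_{t₀}]`
(φ), and `T[𝒳_{t₀}] = 1` by the normalisation, legitimate since `[𝒳_{t₀}] ∪ Kᵈ = j_{t₀*}(K_{t₀}ᵈ) ≠ 0`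
(§1 and part XI's top-degree injectivity). [cite: Abdulali1994FamiliesAV, Conjecture 5.3 (p. 1130)]
[cite: VoisinHodgeII2003, proof of Thm. 10.17 (10.7)] [cite: Fulton1998, §19.1 proof of Prop. 19.1.1] -/
theorem fibreClassLefschetz_degZero {d : ℕ} {f : 𝒳 ⟶ S} (hf : IsCompactAbelianPencil f d) :
    ∃ T : complexBetti 𝒳 (2 * (0 + 1)) →ₗ[ℂ] complexBetti 𝒳 (2 * 0),
      IsAlgebraicCorrespondence (d + 1) (d + 1) 𝒳 𝒳 T ∧
        ∀ (W : complexBetti 𝒳 (2 * 0)) (t s : ComplexPoints S),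
          complexBetti.map (fiberι f s) (2 * 0) (T (fiberGysin hf t 0 (complexBetti.map (fiberι f t) (2 * 0) W))) =
            complexBetti.map (fiberι f s) (2 * 0) W := by
  have h𝒳 := hf.isSmoothProjective_total
  obtain ⟨K, hKalg, hKL⟩ := exists_algebraic_lefschetzClass hf
  obtain ⟨τ, hτ0, hτT⟩ := exists_crossTrace h𝒳 h𝒳
  have h0 : 0 + 2 * d = 2 * d := by omega
  have hak : 2 * (0 + 1) + 2 * d = 2 * (d + 1) := by omega
  set Kd := lefschetzPowTo K d 0 (2 * d) h0 (singularCohomology.one ℂ (ComplexPoints 𝒳)) with hKd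
  have hKdalg : Kd ∈ algebraicClasses 𝒳 d := lefschetzPowTo_one_mem_algebraicClasses_of_mem h𝒳 hKalg d h0
  have h1alg : ∀ c₀ : ℂ, c₀ • (singularCohomology.one ℂ (ComplexPoints 𝒳) : complexBetti 𝒳 (2 * 0)) ∈
      algebraicClasses 𝒳 0 := fun _ ↦ by
    rw [algebraicClasses_zero]
    exact Submodule.mem_top
  rcases isEmpty_or_nonempty (ComplexPoints S) with hS | ⟨⟨t₀⟩⟩
  · obtain ⟨T, hT, -⟩ := hτT hak (Nat.zero_le _) 0 Fin.elim0 Fin.elim0 (fun i ↦ i.elim0) (fun i ↦ i.elim0)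
    exact ⟨T, hT, fun W t s ↦ (IsEmpty.false t).elim⟩
  -- the fibre class and the normalising constant
  set F := fiberGysin hf t₀ 0 (singularCohomology.one ℂ (ComplexPoints (fiberOver f t₀))) with hF
  set c := τ (cupProduct hak F Kd) with hc
  have hc0 : c ≠ 0 := by
    intro h
    have h1 : cupProduct hak F Kd = 0 := hτ0 _ h
    have hcomm := cupProduct_gradedComm_holds ℂ _ hak (show 2 * d + 2 * (0 + 1) = 2 * (d + 1) by ring) F Kd
    rw [h1, eq_comm, smul_eq_zero] at hcomm
    have h2 : cupProduct (show 2 * d + 2 * (0 + 1) = 2 * (d + 1) by ring) Kd F = 0 := by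
      rcases hcomm with h | h
      · exact absurd h (by simp)
      · exact h
    rw [hF, ← fiberGysin_map_fiberι_eq_cupProduct hf t₀ Kd] at h2
    exact map_fiberι_lefschetzPowTo_one_ne_zero hf hKL h0 t₀ (fiberGysin_top_injective hf t₀ h2)
  obtain ⟨T, hT, hTc⟩ := hτT hak (Nat.zero_le _) 1
    (fun _ ↦ c⁻¹ • (singularCohomology.one ℂ (ComplexPoints 𝒳) : complexBetti 𝒳 (2 * 0))) (fun _ ↦ Kd)
    (fun _ ↦ h1alg _) (fun _ ↦ hKdalg)
  refine ⟨T, hT, fun W t s ↦ ?_⟩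
  obtain ⟨w, hw⟩ := exists_eq_smul_one complexOrientationFamily h𝒳 W
  have hLt : fiberGysin hf t 0 (complexBetti.map (fiberι f t) (2 * 0) W) = w • F := by
    rw [hw, map_smul, map_smul,
      show complexBetti.map (fiberι f t) (2 * 0) (singularCohomology.one ℂ (ComplexPoints 𝒳)) =
        singularCohomology.one ℂ (ComplexPoints (fiberOver f t)) from
        Literature.AlgebraicTopology.SingularHomology.singularCohomology.map_one _,
      fibreClassConstantOn_holds hf t t₀]
  rw [hLt, map_smul, hTc, Fin.sum_univ_one, ← hc, smul_smul, smul_smul, mul_assoc, mul_inv_cancel₀ hc0,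
    mul_one, ← hw]

/-! ## §3 Degree `p = d`: the cycle `Hᵈ × 𝒳` -/

/-- **The top clause `p = d` of (β′_f), UNCONDITIONALLY, for every compact pencil of abelian `d`-folds**: there is
`T : H²ᵈ⁺²(𝒳(ℂ)) → H²ᵈ(𝒳(ℂ))` induced by an algebraic correspondence — the action of the codimension-`d` class
`c₀ · pr₁^*(Kᵈ)` (`= c₀ · [Hᵈ × 𝒳]`, `c₀ = τ(j_{t₀*} K_{t₀}ᵈ)⁻¹`) — with `j_s^* T(j_{t*} j_t^* W) = j_s^* W` for all
`W ∈ H²ᵈ(𝒳)`, `t`, `s`: `H²ᵈ(𝒳_{t₀})` is the line through `K_{t₀}ᵈ ≠ 0` (§1), so `j_{t₀}^* W = a · K_{t₀}ᵈ`,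
`j_{t*} j_t^* W = j_{t₀*} j_{t₀}^* W = a · j_{t₀*} K_{t₀}ᵈ` (φ), `T` of it is `a · Kᵈ` by the normalisation, and
`j_s^*(W - a Kᵈ) = 0` for every `s` because it vanishes at `t₀` (flatness). [cite: Abdulali1994FamiliesAV, Conjecture 5.3 (p. 1130)]
[cite: VoisinHodgeII2003, proof of Thm. 10.17 (10.7)] [cite: Andre1996Motifs, §5.1 (p. 25)] -/
theorem fibreClassLefschetz_degTop {d : ℕ} {f : 𝒳 ⟶ S} (hf : IsCompactAbelianPencil f d) :
    ∃ T : complexBetti 𝒳 (2 * (d + 1)) →ₗ[ℂ] complexBetti 𝒳 (2 * d),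
      IsAlgebraicCorrespondence (d + 1) (d + 1) 𝒳 𝒳 T ∧
        ∀ (W : complexBetti 𝒳 (2 * d)) (t s : ComplexPoints S),
          complexBetti.map (fiberι f s) (2 * d) (T (fiberGysin hf t d (complexBetti.map (fiberι f t) (2 * d) W))) =
            complexBetti.map (fiberι f s) (2 * d) W := by
  have h𝒳 := hf.isSmoothProjective_total
  obtain ⟨K, hKalg, hKL⟩ := exists_algebraic_lefschetzClass hf
  obtain ⟨τ, hτ0, hτT⟩ := exists_crossTrace h𝒳 h𝒳
  have h0 : 0 + 2 * d = 2 * d := by omega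
  have hak : 2 * (d + 1) + 2 * 0 = 2 * (d + 1) := by omega
  set Kd := lefschetzPowTo K d 0 (2 * d) h0 (singularCohomology.one ℂ (ComplexPoints 𝒳)) with hKd
  have hKdalg : Kd ∈ algebraicClasses 𝒳 d := lefschetzPowTo_one_mem_algebraicClasses_of_mem h𝒳 hKalg d h0
  have h1alg : (singularCohomology.one ℂ (ComplexPoints 𝒳) : complexBetti 𝒳 (2 * 0)) ∈ algebraicClasses 𝒳 0 := by
    rw [algebraicClasses_zero]
    exact Submodule.mem_top
  rcases isEmpty_or_nonempty (ComplexPoints S) with hS | ⟨⟨t₀⟩⟩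
  · obtain ⟨T, hT, -⟩ := hτT hak (Nat.le_succ d) 0 Fin.elim0 Fin.elim0 (fun i ↦ i.elim0) (fun i ↦ i.elim0)
    exact ⟨T, hT, fun W t s ↦ (IsEmpty.false t).elim⟩
  -- `j_{t₀*} K_{t₀}ᵈ ≠ 0` and the normalising constant
  set LKd := fiberGysin hf t₀ d (complexBetti.map (fiberι f t₀) (2 * d) Kd) with hLKd
  have hLKd0 : LKd ≠ 0 := fun h ↦
    map_fiberι_lefschetzPowTo_one_ne_zero hf hKL h0 t₀ (fiberGysin_top_injective hf t₀ h)
  set c := τ LKd with hc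
  have hc0 : c ≠ 0 := fun h ↦ hLKd0 (hτ0 _ h)
  obtain ⟨T, hT, hTc⟩ := hτT hak (Nat.le_succ d) 1 (fun _ ↦ c⁻¹ • Kd)
    (fun _ ↦ (singularCohomology.one ℂ (ComplexPoints 𝒳) : complexBetti 𝒳 (2 * 0)))
    (fun _ ↦ Submodule.smul_mem _ _ hKdalg) (fun _ ↦ h1alg)
  refine ⟨T, hT, fun W t s ↦ ?_⟩
  -- `j_{t₀}^* W = a • K_{t₀}ᵈ`
  obtain ⟨a, ha⟩ := exists_eq_smul_of_top complexOrientationFamily (hf.isSmoothProjective_fiberOver t₀)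
    (map_fiberι_lefschetzPowTo_one_ne_zero hf hKL h0 t₀) (complexBetti.map (fiberι f t₀) (2 * d) W)
  have hdiff : complexBetti.map (fiberι f t₀) (2 * d) (W - a • Kd) = 0 := by
    rw [map_sub, map_smul, ha, sub_self]
  have hs : complexBetti.map (fiberι f s) (2 * d) W = a • complexBetti.map (fiberι f s) (2 * d) Kd := by
    have h := map_fiberι_eq_zero_of_eq_zero hf hdiff s
    rwa [map_sub, map_smul, sub_eq_zero] at h
  rw [fiberGysin_map_fiberι_eq_of_const hf (fibreClassConstantOn_holds hf) t t₀ W, ha, map_smul, ← hLKd,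
    map_smul, hTc, Fin.sum_univ_one, cupProduct_one', ← hc, smul_smul, smul_smul, mul_assoc,
    mul_inv_cancel₀ hc0, mul_one, map_smul, hs]

/-! ## §4 Assembly: (β′_f) for compact pencils of abelian SURFACES with divisorial invariant `H²` -/

/-- **(β′_f) FOR COMPACT PENCILS OF ABELIAN SURFACES WITH DIVISOR-SPANNED INVARIANT `H²` — UNCONDITIONAL, WITH
EXPLICIT CYCLES.** For a compact pencil `f : 𝒳 ⟶ S` of abelian surfaces (`𝒳` a smooth projective threefold) and
a point `t₀` such that `j_{t₀}^* H²(𝒳(ℂ); ℂ)` is spanned by restrictions of divisor classes of `𝒳`, part VIII's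
repaired fibre-class Lefschetz node `FibreClassLefschetzOn hf` HOLDS: in each degree `p ≤ 2` cup-with-the-fibre-class
is inverted on fibre restrictions by an algebraic correspondence of `𝒳`, given by the codimension-`2` cycles
`𝒳 × H²` (`p = 0`, §2), `∑ᵢ Dᵢ × Aᵢ` (`p = 1`, part XIV-b: products of divisors), `H² × 𝒳` (`p = 2`, §3) on the
sixfold `𝒳 × 𝒳`. This is the typed form of Abdulali's Conjecture 5.3 / the base half of `B(𝒳)` for these
threefolds, the first rung of the Lefschetz-type ladder with Hodge-theoretic content (parts XI/X-d: `d ≤ 1`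
unconditional; `d = 2` previously needed the codimension-`2` Hodge classes of `𝒳 × 𝒳`). No Hodge-conjecture
input, no named fact, no supply node; axioms standard. [cite: Abdulali1994FamiliesAV, Conjecture 5.3 and Theorem 5.5 (p. 1130)]
[cite: Andre1996Motifs, §6.3 Remarque 2 (p. 33)] [cite: VoisinHodgeII2003, proof of Thm. 10.17 (10.7)] -/
theorem fibreClassLefschetzOn_relDim_two_of_divisorSpan {f : 𝒳 ⟶ S} (hf : IsCompactAbelianPencil f 2)
    (t₀ : ComplexPoints S)
    (hN : ∀ W : complexBetti 𝒳 (2 * 1), ∃ D ∈ algebraicClasses 𝒳 1,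
      complexBetti.map (fiberι f t₀) (2 * 1) D = complexBetti.map (fiberι f t₀) (2 * 1) W) :
    FibreClassLefschetzOn hf := by
  intro p hp
  obtain rfl | rfl | rfl : p = 0 ∨ p = 1 ∨ p = 2 := by omega
  · exact fibreClassLefschetz_degZero hf
  · exact fibreClassLefschetz_degOne_of_divisorSpan hf le_rfl t₀ hN
  · exact fibreClassLefschetz_degTop hf

/-- The cycle-theoretic half (A_f) for these pencils (part X-b's split `(β′_f) ⟺ (κ_f) ∧ (A_f)`): cup with the
fibre class has an ALGEBRAIC quasi-inverse in every degree `p ≤ 2`. [cite: Abdulali1994FamiliesAV, Conjecture 5.3 and Remark 5.4 (p. 1130)] -/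
theorem algebraicFibreClassQuasiInverseOn_relDim_two_of_divisorSpan {f : 𝒳 ⟶ S} (hf : IsCompactAbelianPencil f 2)
    (t₀ : ComplexPoints S)
    (hN : ∀ W : complexBetti 𝒳 (2 * 1), ∃ D ∈ algebraicClasses 𝒳 1,
      complexBetti.map (fiberι f t₀) (2 * 1) D = complexBetti.map (fiberι f t₀) (2 * 1) W) :
    AlgebraicFibreClassQuasiInverseOn hf :=
  algebraicFibreClassQuasiInverseOn_of_fibreClassLefschetzOn hf (fibreClassLefschetzOn_relDim_two_of_divisorSpan hf t₀ hN)

/-- **The extreme degrees of (β′_f) on EVERY compact pencil of abelian `d`-folds, unconditionally** (§2, §3): the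
clauses `p = 0` and `p = d` of `FibreClassLefschetzOn hf`. What remains of (β′_f) in general is `0 < p < d`.
[cite: Abdulali1994FamiliesAV, Conjecture 5.3 (p. 1130)] [cite: Andre1996Motifs, §6.3 Remarque 2 (p. 33)] -/
theorem fibreClassLefschetz_extremeDegrees {d : ℕ} {f : 𝒳 ⟶ S} (hf : IsCompactAbelianPencil f d) (p : ℕ)
    (hp : p = 0 ∨ p = d) :
    ∃ T : complexBetti 𝒳 (2 * (p + 1)) →ₗ[ℂ] complexBetti 𝒳 (2 * p),
      IsAlgebraicCorrespondence (d + 1) (d + 1) 𝒳 𝒳 T ∧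
        ∀ (W : complexBetti 𝒳 (2 * p)) (t s : ComplexPoints S),
          complexBetti.map (fiberι f s) (2 * p) (T (fiberGysin hf t p (complexBetti.map (fiberι f t) (2 * p) W))) =
            complexBetti.map (fiberι f s) (2 * p) W := by
  rcases hp with rfl | rfl
  · exact fibreClassLefschetz_degZero hf
  · exact fibreClassLefschetz_degTop hf

end Summit.HodgeConjecture.HodgeConjecture.Ring2.AbelianAll

end
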